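import Literature.Analysis.FluidPDE.TorusPressurePoisson
import Literature.MathematicalPhysics.KineticTheory.HardSphereEuler

/-!
# Interpolation of first and second derivatives on `𝕋³` (levels 1, 2 from levels 0, 2 resp. 1, 3)

Helper file for the line `log-lipschitz-budget` of the crux `ImplosionDichotomy.PolynomialCompression`
(stmt-AtomisticToContinuum-12587), stub `stub_logBudgetShadowing`: the level-1 and level-2 shadowing
energies are NOT estimated by their own energy inequalities but interpolated between levels 0/2 and
1/3 (integration by parts on the torus, no boundary terms, and Cauchy–Schwarz):
`Σₗ ∫ (∂ₗf)² = -∫ f Δf ≤ ‖f‖₂ ‖Δf‖₂ ≤ ‖f‖₂ · √(3 Σᵢₗ ∫ (∂ᵢ∂ₗf)²)` and one level up.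
-/

noncomputable section

namespace Summit.AtomisticToContinuum.HydrodynamicLimit.Theorems

open Set MeasureTheory
open Literature.MathematicalPhysics.KineticTheory Literature.Analysis.FunctionSpaces

/-- Cauchy–Schwarz on `𝕋³` for continuous real functions:
`|∫ f g| ≤ √(∫ f²) √(∫ g²)` (Hölder with `p = q = 2` applied to `|f|, |g|`). [folklore] -/
private theorem abs_integral_mul_le {f g : T3 → ℝ} (hf : Continuous f) (hg : Continuous g) :
    |∫ x, f x * g x| ≤ Real.sqrt (∫ x, f x ^ 2) * Real.sqrt (∫ x, g x ^ 2) := by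
  have h2 : ENNReal.ofReal (2 : ℝ) = 2 := by simp
  have hfm : MemLp (fun x => |f x|) (ENNReal.ofReal 2) volume := by
    rw [h2]
    exact (continuous_abs.comp hf).memLp_of_hasCompactSupport (HasCompactSupport.of_compactSpace _)
  have hgm : MemLp (fun x => |g x|) (ENNReal.ofReal 2) volume := by
    rw [h2]
    exact (continuous_abs.comp hg).memLp_of_hasCompactSupport (HasCompactSupport.of_compactSpace _)
  have hH := integral_mul_le_Lp_mul_Lq_of_nonneg (μ := volume) Real.HolderConjugate.two_two
    (ae_of_all _ fun x => abs_nonneg (f x)) (ae_of_all _ fun x => abs_nonneg (g x)) hfm hgm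
  simp only [Real.rpow_two, sq_abs] at hH
  rw [Real.sqrt_eq_rpow, Real.sqrt_eq_rpow]
  calc |∫ x, f x * g x| ≤ ∫ x, |f x * g x| := abs_integral_le_integral_abs
    _ = ∫ x, |f x| * |g x| := integral_congr_ae (ae_of_all _ fun x => abs_mul _ _)
    _ ≤ _ := hH

/-- `(∑ᵢ cᵢ)² ≤ 3 ∑ᵢ cᵢ²` on `Fin 3`. [folklore] -/
private theorem sq_sum_fin_three_le (c : Fin 3 → ℝ) : (∑ i, c i) ^ 2 ≤ 3 * ∑ i, c i ^ 2 := by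
  have h := sq_sum_le_card_mul_sum_sq (s := (Finset.univ : Finset (Fin 3))) (f := c)
  simpa using h

/-- **Scalar interpolation for a finite family.** For smooth real `g_a` on `𝕋³`:
`∑ᵢ ∑ₐ ∫ (∂ᵢ g_a)² ≤ √(∑ₐ ∫ g_a²) · √(3 ∑ⱼ ∑ᵢ ∑ₐ ∫ (∂ⱼ∂ᵢ g_a)²)`
(`∑ᵢ ∫ (∂ᵢg)² = -∫ g ∑ᵢ ∂ᵢ∂ᵢg` by parts, Cauchy–Schwarz in `x` and in `a`). [folklore] -/
private theorem interp_family {ι : Type*} [Fintype ι] {g : ι → T3 → ℝ}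
    (hg : ∀ a, Torus.IsSmooth (g a)) :
    (∑ i, ∑ a, ∫ x, Torus.partialDeriv i (g a) x ^ 2) ≤
      Real.sqrt (∑ a, ∫ x, g a x ^ 2) *
        Real.sqrt (3 * ∑ j, ∑ i, ∑ a, ∫ x,
          Torus.partialDeriv j (Torus.partialDeriv i (g a)) x ^ 2) := by
  have key : ∀ a, (∑ i, ∫ x, Torus.partialDeriv i (g a) x ^ 2) ≤
      Real.sqrt (∫ x, g a x ^ 2) *
        Real.sqrt (3 * ∑ j, ∑ i, ∫ x,
          Torus.partialDeriv j (Torus.partialDeriv i (g a)) x ^ 2) := by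
    intro a
    have hga : Torus.IsSmooth (g a) := hg a
    have h1 : ∀ i, Torus.IsSmooth (Torus.partialDeriv i (g a)) := fun i => hga.partialDeriv i
    have h2 : ∀ j i, Torus.IsSmooth (Torus.partialDeriv j (Torus.partialDeriv i (g a))) :=
      fun j i => (h1 i).partialDeriv j
    have hLc : Continuous fun x => ∑ i, Torus.partialDeriv i (Torus.partialDeriv i (g a)) x :=
      continuous_finsetSum _ fun i _ => (h2 i i).continuous
    -- integration by parts, summed over `i`
    have hibp : (∑ i, ∫ x, Torus.partialDeriv i (g a) x ^ 2) =
        -∫ x, g a x * ∑ i, Torus.partialDeriv i (Torus.partialDeriv i (g a)) x := by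
      have hint : ∀ i, Integrable
          (fun x => g a x * Torus.partialDeriv i (Torus.partialDeriv i (g a)) x) volume :=
        fun i => (hga.continuous.mul (h2 i i).continuous).integrable_unitAddTorus
      calc (∑ i, ∫ x, Torus.partialDeriv i (g a) x ^ 2)
          = ∑ i, -∫ x, g a x * Torus.partialDeriv i (Torus.partialDeriv i (g a)) x := by
            refine Finset.sum_congr rfl fun i _ => ?_
            rw [← Literature.Analysis.FluidPDE.Torus.integral_partialDeriv_mul_eq_neg_integral
              hga (h1 i) i]
            exact integral_congr_ae (ae_of_all _ fun x => by ring)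
        _ = -∫ x, ∑ i, g a x * Torus.partialDeriv i (Torus.partialDeriv i (g a)) x := by
            rw [Finset.sum_neg_distrib, integral_finsetSum _ fun i _ => hint i]
        _ = -∫ x, g a x * ∑ i, Torus.partialDeriv i (Torus.partialDeriv i (g a)) x := by
            congr 1
            exact integral_congr_ae (ae_of_all _ fun x => by simp only [Finset.mul_sum])
    -- Cauchy–Schwarz in `x`
    have hcs := abs_integral_mul_le hga.continuous hLc
    -- `∫ (∑ᵢ ∂ᵢ∂ᵢg)² ≤ 3 ∑ᵢ ∫ (∂ᵢ∂ᵢg)² ≤ 3 ∑ⱼ ∑ᵢ ∫ (∂ⱼ∂ᵢg)²`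
    have hlap : ∫ x, (∑ i, Torus.partialDeriv i (Torus.partialDeriv i (g a)) x) ^ 2 ≤
        3 * ∑ j, ∑ i, ∫ x, Torus.partialDeriv j (Torus.partialDeriv i (g a)) x ^ 2 := by
      have hint2 : ∀ j i, Integrable
          (fun x => Torus.partialDeriv j (Torus.partialDeriv i (g a)) x ^ 2) volume :=
        fun j i => ((h2 j i).continuous.pow 2).integrable_unitAddTorus
      have hdiag : (∑ i, ∫ x, Torus.partialDeriv i (Torus.partialDeriv i (g a)) x ^ 2) ≤
          ∑ j, ∑ i, ∫ x, Torus.partialDeriv j (Torus.partialDeriv i (g a)) x ^ 2 := by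
        calc (∑ i, ∫ x, Torus.partialDeriv i (Torus.partialDeriv i (g a)) x ^ 2)
            ≤ ∑ i, ∑ j, ∫ x, Torus.partialDeriv j (Torus.partialDeriv i (g a)) x ^ 2 :=
              Finset.sum_le_sum fun i _ =>
                Finset.single_le_sum
                  (f := fun j => ∫ x, Torus.partialDeriv j (Torus.partialDeriv i (g a)) x ^ 2)
                  (fun j _ => integral_nonneg fun x => sq_nonneg _) (Finset.mem_univ i)
          _ = ∑ j, ∑ i, ∫ x, Torus.partialDeriv j (Torus.partialDeriv i (g a)) x ^ 2 :=
              Finset.sum_comm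
      calc ∫ x, (∑ i, Torus.partialDeriv i (Torus.partialDeriv i (g a)) x) ^ 2
          ≤ ∫ x, 3 * ∑ i, Torus.partialDeriv i (Torus.partialDeriv i (g a)) x ^ 2 :=
            integral_mono (hLc.pow 2).integrable_unitAddTorus
              ((integrable_finsetSum _ fun i _ => hint2 i i).const_mul 3)
              fun x => sq_sum_fin_three_le _
        _ = 3 * ∑ i, ∫ x, Torus.partialDeriv i (Torus.partialDeriv i (g a)) x ^ 2 := by
            rw [integral_const_mul, integral_finsetSum _ fun i _ => hint2 i i]
        _ ≤ 3 * ∑ j, ∑ i, ∫ x, Torus.partialDeriv j (Torus.partialDeriv i (g a)) x ^ 2 :=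
            mul_le_mul_of_nonneg_left hdiag (by norm_num)
    -- assemble
    calc (∑ i, ∫ x, Torus.partialDeriv i (g a) x ^ 2)
        = -∫ x, g a x * ∑ i, Torus.partialDeriv i (Torus.partialDeriv i (g a)) x := hibp
      _ ≤ |∫ x, g a x * ∑ i, Torus.partialDeriv i (Torus.partialDeriv i (g a)) x| := neg_le_abs _
      _ ≤ Real.sqrt (∫ x, g a x ^ 2) *
            Real.sqrt (∫ x, (∑ i, Torus.partialDeriv i (Torus.partialDeriv i (g a)) x) ^ 2) := hcs
      _ ≤ _ := mul_le_mul_of_nonneg_left (Real.sqrt_le_sqrt hlap) (Real.sqrt_nonneg _)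
  -- Cauchy–Schwarz in `a`
  have hA0 : ∀ a, 0 ≤ ∫ x, g a x ^ 2 := fun a => integral_nonneg fun x => sq_nonneg _
  have hD0 : ∀ a, 0 ≤ 3 * ∑ j, ∑ i, ∫ x,
      Torus.partialDeriv j (Torus.partialDeriv i (g a)) x ^ 2 :=
    fun a => mul_nonneg (by norm_num) (Finset.sum_nonneg fun j _ => Finset.sum_nonneg fun i _ =>
      integral_nonneg fun x => sq_nonneg _)
  have hsum : (∑ a, 3 * ∑ j, ∑ i, ∫ x,
      Torus.partialDeriv j (Torus.partialDeriv i (g a)) x ^ 2) =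
      3 * ∑ j, ∑ i, ∑ a, ∫ x, Torus.partialDeriv j (Torus.partialDeriv i (g a)) x ^ 2 := by
    rw [← Finset.mul_sum]
    congr 1
    calc (∑ a, ∑ j, ∑ i, ∫ x, Torus.partialDeriv j (Torus.partialDeriv i (g a)) x ^ 2)
        = ∑ j, ∑ a, ∑ i, ∫ x, Torus.partialDeriv j (Torus.partialDeriv i (g a)) x ^ 2 :=
          Finset.sum_comm
      _ = ∑ j, ∑ i, ∑ a, ∫ x, Torus.partialDeriv j (Torus.partialDeriv i (g a)) x ^ 2 :=
          Finset.sum_congr rfl fun j _ => Finset.sum_comm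
  calc (∑ i, ∑ a, ∫ x, Torus.partialDeriv i (g a) x ^ 2)
      = ∑ a, ∑ i, ∫ x, Torus.partialDeriv i (g a) x ^ 2 := Finset.sum_comm
    _ ≤ ∑ a, Real.sqrt (∫ x, g a x ^ 2) *
          Real.sqrt (3 * ∑ j, ∑ i, ∫ x,
            Torus.partialDeriv j (Torus.partialDeriv i (g a)) x ^ 2) :=
        Finset.sum_le_sum fun a _ => key a
    _ ≤ Real.sqrt (∑ a, ∫ x, g a x ^ 2) *
          Real.sqrt (∑ a, 3 * ∑ j, ∑ i, ∫ x,
            Torus.partialDeriv j (Torus.partialDeriv i (g a)) x ^ 2) :=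
        Real.sum_sqrt_mul_sqrt_le _ hA0 hD0
    _ = _ := by rw [hsum]

/-- `∫ ‖u‖² = ∑_c ∫ u_c²` for a smooth `u : 𝕋³ → ℝ³` (`‖v‖² = ∑_c v_c²` on `EuclideanSpace`). [folklore] -/
private theorem integral_norm_sq_eq_sum {u : T3 → V3} (hu : Torus.IsSmooth u) :
    ∫ x, ‖u x‖ ^ 2 = ∑ c, ∫ x, (u x c) ^ 2 := by
  have hint : ∀ c, Integrable (fun x => (u x c) ^ 2) volume :=
    fun c => ((hu.apply c).continuous.pow 2).integrable_unitAddTorus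
  rw [← integral_finsetSum _ fun c _ => hint c]
  refine integral_congr_ae (ae_of_all _ fun x => ?_)
  simp only [EuclideanSpace.norm_sq_eq, Real.norm_eq_abs, sq_abs]

/-- **Vector interpolation for a finite family.** For smooth `g_a : 𝕋³ → ℝ³`:
`∑ᵢ ∑ₐ ∫ ‖∂ᵢ g_a‖² ≤ √(∑ₐ ∫ ‖g_a‖²) · √(3 ∑ⱼ ∑ᵢ ∑ₐ ∫ ‖∂ⱼ∂ᵢ g_a‖²)`
(componentwise reduction to `interp_family` over `ι × Fin 3`). [folklore] -/
private theorem interp_family_vec {ι : Type*} [Fintype ι] {g : ι → T3 → V3}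
    (hg : ∀ a, Torus.IsSmooth (g a)) :
    (∑ i, ∑ a, ∫ x, ‖Torus.partialDeriv i (g a) x‖ ^ 2) ≤
      Real.sqrt (∑ a, ∫ x, ‖g a x‖ ^ 2) *
        Real.sqrt (3 * ∑ j, ∑ i, ∑ a, ∫ x,
          ‖Torus.partialDeriv j (Torus.partialDeriv i (g a)) x‖ ^ 2) := by
  have h1 : ∀ a i, Torus.IsSmooth (Torus.partialDeriv i (g a)) := fun a i => (hg a).partialDeriv i
  have hc0 : ∀ a c, Torus.IsSmooth (fun y => g a y c) := fun a c => (hg a).apply c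
  have e1 : ∀ a i x c, Torus.partialDeriv i (g a) x c = Torus.partialDeriv i (fun y => g a y c) x :=
    fun a i x c => (Torus.partialDeriv_apply_coord ((hg a).isContDiff (by simp)) i x c).symm
  have e2 : ∀ a j i x c, Torus.partialDeriv j (Torus.partialDeriv i (g a)) x c =
      Torus.partialDeriv j (Torus.partialDeriv i (fun y => g a y c)) x := by
    intro a j i x c
    rw [← Torus.partialDeriv_apply_coord ((h1 a i).isContDiff (by simp)) j x c]
    congr 1
    funext y
    exact e1 a i y c
  have h := interp_family (ι := ι × Fin 3) (g := fun p => fun y => g p.1 y p.2) (fun p => hc0 p.1 p.2)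
  simp only [Fintype.sum_prod_type] at h
  simp only [integral_norm_sq_eq_sum (hg _), integral_norm_sq_eq_sum (h1 _ _),
    integral_norm_sq_eq_sum ((h1 _ _).partialDeriv _), e1, e2]
  exact h

/-- **Interpolation on `𝕋³`, scalar and vector fields.** For a smooth real `f` on `𝕋³`:
`Σₗ ∫ (∂ₗf)² ≤ √(∫ f²) · √(3 Σᵢ Σₗ ∫ (∂ᵢ∂ₗ f)²)` and
`Σᵢ Σₗ ∫ (∂ᵢ∂ₗf)² ≤ √(Σₗ ∫ (∂ₗf)²) · √(3 Σⱼ Σᵢ Σₗ ∫ (∂ⱼ∂ᵢ∂ₗ f)²)`; the same for a smooth `V3`-valued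
`f` with squared norms (integration by parts `∫ (∂ᵢa) b = -∫ a ∂ᵢb` on the torus, `(Σᵢ cᵢ)² ≤ 3 Σᵢ cᵢ²`,
Cauchy–Schwarz in `L²` and in the finite sums). [folklore] -/
theorem shadow_interpolation :
    (∀ {f : T3 → ℝ}, Torus.IsSmooth f →
      (∑ l, ∫ x, Torus.partialDeriv l f x ^ 2) ≤
        Real.sqrt (∫ x, f x ^ 2) *
          Real.sqrt (3 * ∑ i, ∑ l, ∫ x, Torus.partialDeriv i (Torus.partialDeriv l f) x ^ 2)) ∧
    (∀ {f : T3 → ℝ}, Torus.IsSmooth f →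
      (∑ i, ∑ l, ∫ x, Torus.partialDeriv i (Torus.partialDeriv l f) x ^ 2) ≤
        Real.sqrt (∑ l, ∫ x, Torus.partialDeriv l f x ^ 2) *
          Real.sqrt (3 * ∑ j, ∑ i, ∑ l, ∫ x,
            Torus.partialDeriv j (Torus.partialDeriv i (Torus.partialDeriv l f)) x ^ 2)) ∧
    (∀ {f : T3 → V3}, Torus.IsSmooth f →
      (∑ l, ∫ x, ‖Torus.partialDeriv l f x‖ ^ 2) ≤
        Real.sqrt (∫ x, ‖f x‖ ^ 2) *
          Real.sqrt (3 * ∑ i, ∑ l, ∫ x, ‖Torus.partialDeriv i (Torus.partialDeriv l f) x‖ ^ 2)) ∧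
    (∀ {f : T3 → V3}, Torus.IsSmooth f →
      (∑ i, ∑ l, ∫ x, ‖Torus.partialDeriv i (Torus.partialDeriv l f) x‖ ^ 2) ≤
        Real.sqrt (∑ l, ∫ x, ‖Torus.partialDeriv l f x‖ ^ 2) *
          Real.sqrt (3 * ∑ j, ∑ i, ∑ l, ∫ x,
            ‖Torus.partialDeriv j (Torus.partialDeriv i (Torus.partialDeriv l f)) x‖ ^ 2)) := by
  refine ⟨fun {f} hf => ?_, fun {f} hf => ?_, fun {f} hf => ?_, fun {f} hf => ?_⟩
  · have h := interp_family (ι := Unit) (g := fun _ => f) (fun _ => hf)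
    simpa using h
  · exact interp_family (g := fun l => Torus.partialDeriv l f) (fun l => hf.partialDeriv l)
  · have h := interp_family_vec (ι := Unit) (g := fun _ => f) (fun _ => hf)
    simpa using h
  · exact interp_family_vec (g := fun l => Torus.partialDeriv l f) (fun l => hf.partialDeriv l)

end Summit.AtomisticToContinuum.HydrodynamicLimit.Theorems

end
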